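import Literature.NumberTheory.EllipticCurves.JetchevSkinnerWan2017.SigmaLocalTotallySplitGoodProofs
import Literature.NumberTheory.EllipticCurves.PrimaryTorsionLocalH1FiniteProofs
import Literature.NumberTheory.EllipticCurves.TorsionFrobeniusKernelCountProofs
import Literature.NumberTheory.EllipticCurves.PrimaryTorsionContinuousSMulProofs
import Mathlib.GroupTheory.PGroup
import HarnessLib

/-!
# The local term of the `Σ`-change at a totally split place of GOOD reduction — PROVED
# UNCONDITIONALLY: `#H¹(K_w, E[p^∞]) ∣ #E(K_w)[p^∞] ∣ #Ẽ_w(k_w) = P_w|_{u=1}`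

Topic `Literature/NumberTheory/EllipticCurves/JetchevSkinnerWan2017` (sibling of the named LOCAL fact
`sigmaLocal_charIdeal_eulerFactor_mem_of_noTamagawaDefect`). THEOREMS ONLY (no definition, no named
fact, no instance, no `sorry`; D-0026). Cell `bsd-stepL` (typer lane `defn-ty1`, g9): final assembly
(steps C4 + L6) of `HOME/defn-ty1/g9/NOTE-sigmaLocal-discharge-plan-defn-ty1-g9.md` at the totally split
places of GOOD reduction: the hypothesis `hcount` of `sigmaLocal_good_totallySplit_of_natCard_h1_dvd`
(p555146) is discharged.

[GreenbergLNM1716] §2 (p. 71) / [Castella2018] Prop. 2.5: for `v ∤ p` of good reduction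
`#H¹(K_v, E[p^∞]) = #E(K_v)[p^∞]`; [Castella2018] Thm. 2.3 (2.7): the local factor at a totally split
`w ∈ Σ` is `(#H¹(K_w, E[p^∞]))`, and `#E(K_w)[p^∞] ∣ #Ẽ_w(k_w) = Nw − a_w + 1 = P_w(1)` (JSW §5.1
Remark on inert places).

## What is proved

For an elliptic curve `W/K` (`K : Type`), a prime `p`, a finite place `w ∤ p` of good reduction, with
`Γ_{K_w}` acting on `E[p^∞]` through `absGaloisRestrict K K_w = localMap K (Sum.inl w)`:
* `natCard_target_le_natCard_invariants` — `#{y ∈ E[p^∞] | #Ẽ_w(k_w)·y = 0 ∧ ρ(φ)y = q_w·y}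
  ≤ #E[p^∞]^{Γ_{K_w}}` (embed in `ker(g − q | E[p^a])`, compare with `ker(g − 1 | E[p^a])` by the
  Weil-pairing count `natCard_smul_eq_natCast_smul_le_natCard_fixed`, and a point fixed by a Frobenius
  lift and by inertia is fixed by `Γ_{K_w}`, `dense_absInertia_mul_zpowers_of_isFrobPow`);
* `natCard_h1_le_natCard_invariants`, **`natCard_h1_dvd_natCard_invariants`** —
  `#H¹(K_w, E[p^∞]) ≤ #E[p^∞]^{Γ_{K_w}}` (with `natCard_h1_primaryTorsion_le`), hence `∣` (both are
  `p`-groups: `IsPGroup.iff_card`);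
* **`sigmaLocal_good_totallySplit`** — for `W/K`, `κ`, a place `w ∤ p` with Euler datum
  `(Nw, good a, 0)` and any topology on `Λ` making the action continuous: the Pontryagin dual of
  `H¹(K_w, T_pE ⊗ Λ^*(Ψ⁻¹))` is a finitely generated torsion `Λ`-module whose characteristic ideal
  contains `eulerFactor p ℤ_[p] Nw (.good a) 0` — the THREE CONJUNCTS of the named local fact at every
  totally split place of good reduction, with no extra hypothesis; `sigmaLocal_good_totallySplit'` drops
  the (provable, `PrimaryTorsion.continuousSMul`) instance binder `[ContinuousSMul ℤ_[p] E[p^∞]]`, and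
  `sigmaLocal_good_totallySplit_baseChange` is the literal instance of the named fact's body at
  `t = good a`, `c = 0` (curve `W.baseChange K` of a curve over `ℚ`, the fact's own binders only).

HONEST FRAMING: places of bad reduction totally split in `K_∞` (`t ∈ {nonsplitMult, additive}`, `c = 0`)
and finitely decomposed places (`c ≠ 0`) are NOT treated; the named fact (all `w ∈ Σ` at once, base
change `W.baseChange K` of a curve over `ℚ`) is NOT discharged by this file.

References: [GreenbergLNM1716] §2; [Castella2018] Thm. 2.3 (2.7), Prop. 2.5; [PollackWeston2011]
Lemma 3.2; [JetchevSkinnerWan2017] §5.1; [MilneADT2006] I Cor. 2.3.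
-/

noncomputable section

open scoped Classical Pointwise
open Field ValuativeRel NumberField IsDedekindDomain IsDedekindDomain.HeightOneSpectrum WeierstrassCurve
open Literature.NumberTheory.EllipticCurves Literature.NumberTheory.EllipticCurves.BigGaloisRep
  Literature.NumberTheory.GaloisRepresentations Literature.NumberTheory.Automorphic
  Literature.NumberTheory.EllipticCurves.IwasawaCharacter
  Literature.NumberTheory.GaloisRepresentations.IsNonarchimedeanLocalField

namespace WeierstrassCurve

variable {K : Type} [Field K] [NumberField K] (W : WeierstrassCurve K) [W.IsElliptic]
  (p : ℕ) [Fact p.Prime] {w : HeightOneSpectrum (𝓞 K)}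

/-! ## §1 A point fixed by a Frobenius lift and by inertia is fixed by `Γ_{K_w}` -/

/-- At a good place `w ∤ p`, a point of `E[p^∞]` fixed by (the restriction of) an arithmetic Frobenius
lift `φ` is fixed by all of `Γ_{K_w}`: its stabiliser is a closed subgroup containing the inertia group
(`primaryTorsionGaloisRep_localMap_inr_apply`) and `φ`, hence the dense set `I_w·⟨φ⟩`
(`dense_absInertia_mul_zpowers_of_isFrobPow`). [cite: SilvermanAEC2009, Prop. VII.4.1(b)]
[cite: NeukirchSchmidtWingberg2008, Thm. 7.5.3] -/
theorem primaryTorsionGaloisRep_apply_eq_of_frob_fixed (hw : ((p : ℕ) : 𝓞 K) ∉ w.asIdeal)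
    (hgood : W.HasGoodReductionAt w) {φ : absoluteGaloisGroup (w.adicCompletion K)} (hφ : IsFrobPow φ 1)
    {P : PrimaryTorsion (geomPoints W) p}
    (hP : W.primaryTorsionGaloisRep p (absGaloisRestrict K (w.adicCompletion K) φ) P = P)
    (δ : absoluteGaloisGroup (w.adicCompletion K)) :
    W.primaryTorsionGaloisRep p (absGaloisRestrict K (w.adicCompletion K) δ) P = P := by
  let S : Subgroup (absoluteGaloisGroup (w.adicCompletion K)) :=
    { carrier := {δ | W.primaryTorsionGaloisRep p (absGaloisRestrict K (w.adicCompletion K) δ) P = P}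
      one_mem' := by
        change W.primaryTorsionGaloisRep p (absGaloisRestrict K (w.adicCompletion K) 1) P = P
        rw [map_one, map_one]; rfl
      mul_mem' := fun {a b} ha hb ↦ by
        change W.primaryTorsionGaloisRep p (absGaloisRestrict K (w.adicCompletion K) (a * b)) P = P
        change W.primaryTorsionGaloisRep p (absGaloisRestrict K (w.adicCompletion K) a) P = P at ha
        change W.primaryTorsionGaloisRep p (absGaloisRestrict K (w.adicCompletion K) b) P = P at hb
        rw [map_mul, map_mul, Module.End.mul_apply, hb, ha]
      inv_mem' := fun {a} ha ↦ by
        change W.primaryTorsionGaloisRep p (absGaloisRestrict K (w.adicCompletion K) a⁻¹) P = P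
        change W.primaryTorsionGaloisRep p (absGaloisRestrict K (w.adicCompletion K) a) P = P at ha
        conv_lhs => rw [← ha]
        rw [← Module.End.mul_apply, ← map_mul, ← map_mul, inv_mul_cancel, map_one, map_one]; rfl }
  have hmem : ∀ δ, δ ∈ S ↔ W.primaryTorsionGaloisRep p (absGaloisRestrict K (w.adicCompletion K) δ) P = P :=
    fun _ ↦ Iff.rfl
  -- closed: the orbit map is continuous into the discrete module
  have hcont : Continuous fun δ : absoluteGaloisGroup (w.adicCompletion K) ↦
      W.primaryTorsionGaloisRep p (absGaloisRestrict K (w.adicCompletion K) δ) P :=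
    (W.primaryTorsionGaloisRep p).continuous_apply₂.comp
      ((absGaloisRestrict K (w.adicCompletion K)).continuous.prodMk continuous_const)
  have hclosed : IsClosed (S : Set (absoluteGaloisGroup (w.adicCompletion K))) :=
    isClosed_eq hcont continuous_const
  -- contains `I_w · ⟨φ⟩`
  have hsub : (absInertia (w.adicCompletion K) : Set (absoluteGaloisGroup (w.adicCompletion K))) *
      (Subgroup.zpowers φ : Set (absoluteGaloisGroup (w.adicCompletion K))) ⊆ S := by
    rintro _ ⟨σ, hσ, t, ht, rfl⟩
    refine S.mul_mem ((hmem σ).2 ?_) ?_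
    · exact W.primaryTorsionGaloisRep_localMap_inr_apply p hgood hw ⟨σ, hσ⟩ P
    · exact (Subgroup.zpowers_le (H := S)).2 hP ht
  have huniv : (S : Set (absoluteGaloisGroup (w.adicCompletion K))) = Set.univ := by
    refine Set.eq_univ_of_univ_subset ?_
    rw [← (dense_absInertia_mul_zpowers_of_isFrobPow (w.adicCompletion K) hφ).closure_eq]
    exact hclosed.closure_subset_iff.2 hsub
  have hδ := Set.eq_univ_iff_forall.1 huniv δ
  exact hδ

/-! ## §2 `#{y | #Ẽ·y = 0, ρ(φ)y = q·y} ≤ #E[p^∞]^{Γ_{K_w}}` -/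

/-- **`#{y ∈ E[p^∞] | #Ẽ_w(k_w)·y = 0 ∧ ρ(φ)y = q_w·y} ≤ #E[p^∞]^{Γ_{K_w}}`** at a good place `w ∤ p`
(`φ` any arithmetic Frobenius lift): the left set embeds in `ker(g − q_w | E[p^a])` for a power `p^a`
killing it, whose order is at most `#ker(g − 1 | E[p^a])` (Weil pairing,
`natCard_smul_eq_natCast_smul_le_natCard_fixed`), and `ker(g − 1 | E[p^a])` embeds in the
`Γ_{K_w}`-invariants (`primaryTorsionGaloisRep_apply_eq_of_frob_fixed`).
[cite: GreenbergLNM1716, §2 (p. 71)] [cite: MilneADT2006, I Cor. 2.3] -/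
theorem natCard_target_le_natCard_invariants (hw : ((p : ℕ) : 𝓞 K) ∉ w.asIdeal)
    (hgood : W.HasGoodReductionAt w) {φ : absoluteGaloisGroup (w.adicCompletion K)} (hφ : IsFrobPow φ 1) :
    Nat.card {y : PrimaryTorsion (geomPoints W) p //
        Nat.card (W.reductionAt w).toAffine.Point • y = 0 ∧
          W.primaryTorsionGaloisRep p (absGaloisRestrict K (w.adicCompletion K) φ) y =
            (Nat.card (IsLocalRing.ResidueField (w.adicCompletionIntegers K)) : ℤ) • y} ≤
      Nat.card ((W.primaryTorsionGaloisRep p).restrict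
        (localMap K (Sum.inl w))).toRepresentation.invariants := by
  haveI hfinT := W.finite_target p φ (w := w)
  haveI hfinI := W.finite_primaryTorsion_invariants p hw hgood
  -- a uniform power `p ^ a`, `a ≥ 1`, killing the target
  obtain ⟨k₀, hk₀⟩ := Finite.exists_le (fun y : {y : PrimaryTorsion (geomPoints W) p //
      Nat.card (W.reductionAt w).toAffine.Point • y = 0 ∧
        W.primaryTorsionGaloisRep p (absGaloisRestrict K (w.adicCompletion K) φ) y =
          (Nat.card (IsLocalRing.ResidueField (w.adicCompletionIntegers K)) : ℤ) • y} ↦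
    (PrimaryTorsion.exists_pow_smul_eq_zero y.1).choose)
  set a : ℕ := k₀ + 1 with ha
  have hkill : ∀ y : {y : PrimaryTorsion (geomPoints W) p //
      Nat.card (W.reductionAt w).toAffine.Point • y = 0 ∧
        W.primaryTorsionGaloisRep p (absGaloisRestrict K (w.adicCompletion K) φ) y =
          (Nat.card (IsLocalRing.ResidueField (w.adicCompletionIntegers K)) : ℤ) • y},
      p ^ a • ((y.1 : PrimaryTorsion (geomPoints W) p) : geomPoints W) = 0 := fun y ↦ by
    have hy := (PrimaryTorsion.exists_pow_smul_eq_zero y.1).choose_spec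
    have hle : (PrimaryTorsion.exists_pow_smul_eq_zero y.1).choose ≤ a := (hk₀ y).trans (Nat.le_succ _)
    rw [← Nat.sub_add_cancel hle, pow_add, mul_smul, hy, smul_zero]
  have h2m : 2 ≤ p ^ a := by
    calc 2 ≤ p := (Fact.out : p.Prime).two_le
      _ = p ^ 1 := (pow_one p).symm
      _ ≤ p ^ a := Nat.pow_le_pow_right (Fact.out : p.Prime).pos (by omega)
  have hm : ¬ ringChar 𝓀[w.adicCompletion K] ∣ p ^ a := fun h ↦
    w.ringChar_residueField_adicCompletion_ne hw
      (((Nat.prime_dvd_prime_iff_eq ringChar_residueField_prime (Fact.out : p.Prime)).mp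
        (ringChar_residueField_prime.dvd_of_dvd_pow h)))
  -- `q_w` in the two currencies
  have hq : (residueFieldCard (w.adicCompletion K) : ℤ) =
      (Nat.card (IsLocalRing.ResidueField (w.adicCompletionIntegers K)) : ℤ) := by
    rw [residueFieldCard_adicCompletion_eq K w, natCard_residueField_adicCompletionIntegers_eq_absNorm]
    rfl
  -- Step 1: embed the target in `ker(g − q | E[p^a])`
  let ι₁ : {y : PrimaryTorsion (geomPoints W) p //
      Nat.card (W.reductionAt w).toAffine.Point • y = 0 ∧
        W.primaryTorsionGaloisRep p (absGaloisRestrict K (w.adicCompletion K) φ) y =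
          (Nat.card (IsLocalRing.ResidueField (w.adicCompletionIntegers K)) : ℤ) • y} →
      {T : geomTorsion W (p ^ a : ℕ) //
        absGaloisRestrict K (w.adicCompletion K) φ • T = residueFieldCard (w.adicCompletion K) • T} :=
    fun y ↦ ⟨⟨((y.1 : PrimaryTorsion (geomPoints W) p) : geomPoints W),
        (Submodule.mem_torsionBy_iff _ _).2 (by rw [natCast_zsmul]; exact hkill y)⟩,
      Subtype.ext (by
        change absGaloisRestrict K (w.adicCompletion K) φ • ((y.1 : PrimaryTorsion (geomPoints W) p) :
            geomPoints W) = ((residueFieldCard (w.adicCompletion K) • _ : geomTorsion W _) : geomPoints W)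
        rw [AddSubgroupClass.coe_nsmul]
        change _ = residueFieldCard (w.adicCompletion K) • ((y.1 : PrimaryTorsion (geomPoints W) p) :
            geomPoints W)
        have h := congrArg PrimaryTorsion.val y.2.2
        rw [val_primaryTorsionGaloisRep_apply] at h
        rw [← natCast_zsmul, hq]
        exact h)⟩
  have hι₁ : Function.Injective ι₁ := fun y y' h ↦
    Subtype.ext (PrimaryTorsion.ext (congrArg (fun t ↦ ((t.1 : geomTorsion W _) : geomPoints W)) h))
  -- Step 3: embed `ker(g − 1 | E[p^a])` in the invariants
  have hTa : ∀ T : {T : geomTorsion W (p ^ a : ℕ) // absGaloisRestrict K (w.adicCompletion K) φ • T = T},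
      p ^ a • ((T.1 : geomTorsion W (p ^ a : ℕ)) : geomPoints W) = 0 := fun T ↦ by
    have h := (Submodule.mem_torsionBy_iff _ _).1 T.1.2
    rw [natCast_zsmul] at h
    exact h
  have hfix : ∀ T : {T : geomTorsion W (p ^ a : ℕ) // absGaloisRestrict K (w.adicCompletion K) φ • T = T},
      W.primaryTorsionGaloisRep p (absGaloisRestrict K (w.adicCompletion K) φ)
        (PrimaryTorsion.mk ((T.1 : geomTorsion W (p ^ a : ℕ)) : geomPoints W) a (hTa T)) =
        PrimaryTorsion.mk ((T.1 : geomTorsion W (p ^ a : ℕ)) : geomPoints W) a (hTa T) := fun T ↦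
    PrimaryTorsion.ext (by
      rw [val_primaryTorsionGaloisRep_apply, PrimaryTorsion.val_mk]
      exact congrArg (fun t : geomTorsion W (p ^ a : ℕ) ↦ (t : geomPoints W)) T.2)
  let ι₂ : {T : geomTorsion W (p ^ a : ℕ) // absGaloisRestrict K (w.adicCompletion K) φ • T = T} →
      ((W.primaryTorsionGaloisRep p).restrict (localMap K (Sum.inl w))).toRepresentation.invariants :=
    fun T ↦ ⟨PrimaryTorsion.mk ((T.1 : geomTorsion W _) : geomPoints W) a (hTa T),
      (Representation.mem_invariants _ _).2 fun δ ↦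
        W.primaryTorsionGaloisRep_apply_eq_of_frob_fixed p hw hgood hφ (hfix T) δ⟩
  have hι₂ : Function.Injective ι₂ := fun T T' h ↦ by
    apply Subtype.ext; apply Subtype.ext
    have h' := congrArg (fun t : ((W.primaryTorsionGaloisRep p).restrict
      (localMap K (Sum.inl w))).toRepresentation.invariants ↦ ((t.1 : PrimaryTorsion (geomPoints W) p) :
        geomPoints W)) h
    exact h'
  haveI : Finite (geomTorsion W (p ^ a : ℕ)) :=
    finite_torsionPoints_holds W (AlgebraicClosure K) (n := ((p ^ a : ℕ) : ℤ)) (by positivity)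
  calc Nat.card _ ≤ Nat.card {T : geomTorsion W (p ^ a : ℕ) //
          absGaloisRestrict K (w.adicCompletion K) φ • T = residueFieldCard (w.adicCompletion K) • T} :=
        Nat.card_le_card_of_injective ι₁ hι₁
    _ ≤ Nat.card {T : geomTorsion W (p ^ a : ℕ) // absGaloisRestrict K (w.adicCompletion K) φ • T = T} :=
        W.natCard_smul_eq_natCast_smul_le_natCard_fixed h2m hm hφ
    _ ≤ Nat.card ((W.primaryTorsionGaloisRep p).restrict
          (localMap K (Sum.inl w))).toRepresentation.invariants :=
        Nat.card_le_card_of_injective ι₂ hι₂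

/-! ## §3 `#H¹(K_w, E[p^∞]) ∣ #E[p^∞]^{Γ_{K_w}}` -/

/-- **`#H¹(K_w, E[p^∞]) ≤ #E[p^∞]^{Γ_{K_w}}`** at a good place `w ∤ p`.
[cite: GreenbergLNM1716, §2 (p. 71, #H¹(K_v, E[p^∞]) = #E(K_v)[p^∞])] [cite: Castella2018, Prop. 2.5] -/
theorem natCard_h1_le_natCard_invariants (hw : ((p : ℕ) : 𝓞 K) ∉ w.asIdeal) (hgood : W.HasGoodReductionAt w)
    [ContinuousSMul ℤ_[p] (PrimaryTorsion (geomPoints W) p)] :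
    Nat.card (continuousCohomology 1 ((W.primaryTorsionGaloisRep p).restrict
      (localMap K (Sum.inl w))).toTopRep) ≤
      Nat.card ((W.primaryTorsionGaloisRep p).restrict
        (localMap K (Sum.inl w))).toRepresentation.invariants := by
  obtain ⟨φ, hφ⟩ := WeierstrassCurve.exists_isFrobPow_one_adicCompletion (K := K) w
  exact (W.natCard_h1_primaryTorsion_le p hw hgood hφ).trans
    (W.natCard_target_le_natCard_invariants p hw hgood hφ)

/-- **`#H¹(K_w, E[p^∞]) ∣ #E[p^∞]^{Γ_{K_w}}`** at a good place `w ∤ p`: both groups are finite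
`p`-groups (`H¹` of a compact group in a discrete `p`-primary module is `p`-primary), so `≤` between
their orders — powers of `p` — is divisibility.
[cite: GreenbergLNM1716, §2 (p. 71)] [cite: Castella2018, Prop. 2.5] -/
theorem natCard_h1_dvd_natCard_invariants (hw : ((p : ℕ) : 𝓞 K) ∉ w.asIdeal) (hgood : W.HasGoodReductionAt w)
    [ContinuousSMul ℤ_[p] (PrimaryTorsion (geomPoints W) p)] :
    Nat.card (continuousCohomology 1 ((W.primaryTorsionGaloisRep p).restrict
      (localMap K (Sum.inl w))).toTopRep) ∣
      Nat.card ((W.primaryTorsionGaloisRep p).restrict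
        (localMap K (Sum.inl w))).toRepresentation.invariants := by
  haveI hfinH : Finite (continuousCohomology 1 ((W.primaryTorsionGaloisRep p).restrict
      (localMap K (Sum.inl w))).toTopRep) := W.finite_h1_primaryTorsion p hw hgood
  haveI hfinI := W.finite_primaryTorsion_invariants p hw hgood
  have hle := W.natCard_h1_le_natCard_invariants p hw hgood
  -- both orders are powers of `p`
  have hA : ∀ y : PrimaryTorsion (geomPoints W) p, ∃ m : ℕ, (p : ℤ_[p]) ^ m • y = 0 := fun y ↦
    (y.exists_pow_smul_eq_zero).imp fun m hm ↦ by
      rw [← Nat.cast_pow, Nat.cast_smul_eq_nsmul]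
      exact PrimaryTorsion.ext (by rw [PrimaryTorsion.val_nsmul, hm, PrimaryTorsion.val_zero])
  haveI : CompactSpace (LocalGroup K (Sum.inl w)) := absoluteGaloisGroup_compactSpace (w.adicCompletion K)
  have hH : IsPGroup p (Multiplicative (continuousCohomology 1 ((W.primaryTorsionGaloisRep p).restrict
      (localMap K (Sum.inl w))).toTopRep)) := fun h ↦ by
    obtain ⟨m, hm⟩ := BigGaloisRep.exists_pow_smul_eq_zero
      ((W.primaryTorsionGaloisRep p).restrict (localMap K (Sum.inl w))).toTopRep (p : ℤ_[p]) hA h.toAdd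
    refine ⟨m, ?_⟩
    rw [← Nat.cast_pow, Nat.cast_smul_eq_nsmul] at hm
    change Multiplicative.ofAdd (Multiplicative.toAdd h) ^ p ^ m = 1
    rw [← ofAdd_nsmul, hm]; rfl
  have hI : IsPGroup p (Multiplicative ((W.primaryTorsionGaloisRep p).restrict
      (localMap K (Sum.inl w))).toRepresentation.invariants) := fun y ↦ by
    obtain ⟨m, hm⟩ := (y.toAdd.1).exists_pow_smul_eq_zero
    refine ⟨m, ?_⟩
    have h0 : p ^ m • Multiplicative.toAdd y = 0 := Subtype.ext (PrimaryTorsion.ext (by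
      rw [Submodule.coe_smul_of_tower, PrimaryTorsion.val_nsmul, hm]; rfl))
    change Multiplicative.ofAdd (Multiplicative.toAdd y) ^ p ^ m = 1
    rw [← ofAdd_nsmul, h0]; rfl
  obtain ⟨i, hi⟩ := (IsPGroup.iff_card.mp hH)
  obtain ⟨j, hj⟩ := (IsPGroup.iff_card.mp hI)
  rw [Nat.card_congr Multiplicative.toAdd] at hi hj
  rw [hi, hj] at hle ⊢
  exact Nat.pow_dvd_pow p ((Nat.pow_le_pow_iff_right (Fact.out : p.Prime).one_lt).mp hle)

end WeierstrassCurve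

/-! ## §4 The named local fact at the totally split places of good reduction, unconditionally -/

namespace Literature.NumberTheory.EllipticCurves.JetchevSkinnerWan2017

variable {K : Type} [Field K] [NumberField K]

/-- **The local term of the `Σ`-change at a TOTALLY SPLIT place of GOOD reduction, PROVED.** For an
elliptic curve `W/K`, a prime `p`, a `ℤ_p`-extension `κ`, a finite place `w ∤ p` with Euler datum
`(Nw, good a, 0)` (`Nw = N(w)`, good reduction with trace `a`, Frobenius exponent `c = 0`), and any
topology on `Λ = ℤ_p⟦T⟧` making the action on `T_pE ⊗ Λ^*` continuous: the Pontryagin dual of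
`H¹(K_w, T_pE ⊗ Λ^*(Ψ⁻¹))` is a finitely generated torsion `Λ`-module and
`P_w = eulerFactor p ℤ_[p] Nw (.good a) 0 = Nw − a + 1 ∈ Ch_Λ` of it — the three conjuncts of
`sigmaLocal_charIdeal_eulerFactor_mem_of_noTamagawaDefect` at such a place, with no extra hypothesis
(`#H¹(K_w, E[p^∞]) ∣ #E(K_w)[p^∞] ∣ #Ẽ_w(k_w)`).
[cite: Castella2018, Thm. 2.3 (2.7) and Prop. 2.5] [cite: PollackWeston2011, Lemma 3.2]
[cite: GreenbergLNM1716, §2 (p. 71)] [cite: JetchevSkinnerWan2017, §5.1 (Remark on inert places)] -/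
theorem sigmaLocal_good_totallySplit
    (W : WeierstrassCurve K) [W.IsElliptic] (p : ℕ) [Fact p.Prime] (κ : ZpExtension K p)
    (w : HeightOneSpectrum (𝓞 K)) (hw : ((p : ℕ) : 𝓞 K) ∉ w.asIdeal) (Nw : ℕ) (a : ℤ)
    (hdata : IsEulerDataAt W κ w Nw (.good a) 0)
    [TopologicalSpace (IwasawaAlgebra p)]
    [ContinuousSMul (IwasawaAlgebra p) (BigRepModule ℤ_[p] p (PrimaryTorsion (geomPoints W) p))]
    [ContinuousSMul ℤ_[p] (PrimaryTorsion (geomPoints W) p)] :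
    Module.Finite (IwasawaAlgebra p) (CharacterModule (continuousCohomology 1
        ((AnticyclotomicBigGaloisRep κ (W.primaryTorsionGaloisRep p)).restrict
          (localMap K (Sum.inl w))).toTopRep)) ∧
      Module.IsTorsion (IwasawaAlgebra p) (CharacterModule (continuousCohomology 1
        ((AnticyclotomicBigGaloisRep κ (W.primaryTorsionGaloisRep p)).restrict
          (localMap K (Sum.inl w))).toTopRep)) ∧
        eulerFactor p ℤ_[p] Nw (.good a) 0 ∈
          Module.charIdeal (IwasawaAlgebra p) (CharacterModule (continuousCohomology 1
            ((AnticyclotomicBigGaloisRep κ (W.primaryTorsionGaloisRep p)).restrict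
              (localMap K (Sum.inl w))).toTopRep)) := by
  have hgood : W.HasGoodReductionAt w := hdata.2.2.1
  haveI : Finite (continuousCohomology 1 ((W.primaryTorsionGaloisRep p).restrict
      (localMap K (Sum.inl w))).toTopRep) := W.finite_h1_primaryTorsion p hw hgood
  exact sigmaLocal_good_totallySplit_of_natCard_h1_dvd W p κ w hw Nw a hdata
    (W.natCard_h1_dvd_natCard_invariants p hw hgood)

/-- `sigmaLocal_good_totallySplit` with the instance binder `[ContinuousSMul ℤ_[p] E[p^∞]]` discharged
by `PrimaryTorsion.continuousSMul` (the binder list is then a sub-list of the named fact's).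
[cite: Castella2018, Thm. 2.3 (2.7) and Prop. 2.5] [cite: GreenbergLNM1716, §2 (p. 71)] -/
theorem sigmaLocal_good_totallySplit'
    (W : WeierstrassCurve K) [W.IsElliptic] (p : ℕ) [Fact p.Prime] (κ : ZpExtension K p)
    (w : HeightOneSpectrum (𝓞 K)) (hw : ((p : ℕ) : 𝓞 K) ∉ w.asIdeal) (Nw : ℕ) (a : ℤ)
    (hdata : IsEulerDataAt W κ w Nw (.good a) 0)
    [TopologicalSpace (IwasawaAlgebra p)]
    [ContinuousSMul (IwasawaAlgebra p) (BigRepModule ℤ_[p] p (PrimaryTorsion (geomPoints W) p))] :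
    Module.Finite (IwasawaAlgebra p) (CharacterModule (continuousCohomology 1
        ((AnticyclotomicBigGaloisRep κ (W.primaryTorsionGaloisRep p)).restrict
          (localMap K (Sum.inl w))).toTopRep)) ∧
      Module.IsTorsion (IwasawaAlgebra p) (CharacterModule (continuousCohomology 1
        ((AnticyclotomicBigGaloisRep κ (W.primaryTorsionGaloisRep p)).restrict
          (localMap K (Sum.inl w))).toTopRep)) ∧
        eulerFactor p ℤ_[p] Nw (.good a) 0 ∈
          Module.charIdeal (IwasawaAlgebra p) (CharacterModule (continuousCohomology 1
            ((AnticyclotomicBigGaloisRep κ (W.primaryTorsionGaloisRep p)).restrict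
              (localMap K (Sum.inl w))).toTopRep)) := by
  haveI : ContinuousSMul ℤ_[p] (PrimaryTorsion (geomPoints W) p) := PrimaryTorsion.continuousSMul
  exact sigmaLocal_good_totallySplit W p κ w hw Nw a hdata

/-- **The body of `sigmaLocal_charIdeal_eulerFactor_mem_of_noTamagawaDefect` at a totally split place
of good reduction (`t = good a`, `c = 0`), PROVED** — same binders as the named fact (curve
`W.baseChange K` of an elliptic curve over `ℚ`, any number field `K : Type`, any `κ`; the fact's
hypotheses `3 ≤ p`, `IsImaginaryQuadratic K`, `κ.IsAnticyclotomic`, `NoTamagawaDefect` are not needed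
in this case). [cite: Castella2018, Thm. 2.3 (2.7) and Prop. 2.5] [cite: PollackWeston2011, Lemma 3.2]
[cite: GreenbergLNM1716, §2 (p. 71)] -/
theorem sigmaLocal_good_totallySplit_baseChange
    (W : WeierstrassCurve ℚ) [W.IsElliptic] (p : ℕ) [Fact p.Prime]
    (K : Type) [Field K] [NumberField K] (κ : ZpExtension K p)
    (w : HeightOneSpectrum (𝓞 K)) (hw : ((p : ℕ) : 𝓞 K) ∉ w.asIdeal) (Nw : ℕ) (a : ℤ)
    (hdata : IsEulerDataAt (W.baseChange K) κ w Nw (.good a) 0)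
    [TopologicalSpace (IwasawaAlgebra p)]
    [ContinuousSMul (IwasawaAlgebra p)
      (BigRepModule ℤ_[p] p (PrimaryTorsion (geomPoints (W.baseChange K)) p))] :
    Module.Finite (IwasawaAlgebra p) (CharacterModule (continuousCohomology 1
        ((AnticyclotomicBigGaloisRep κ ((W.baseChange K).primaryTorsionGaloisRep p)).restrict
          (localMap K (Sum.inl w))).toTopRep)) ∧
      Module.IsTorsion (IwasawaAlgebra p) (CharacterModule (continuousCohomology 1
        ((AnticyclotomicBigGaloisRep κ ((W.baseChange K).primaryTorsionGaloisRep p)).restrict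
          (localMap K (Sum.inl w))).toTopRep)) ∧
        eulerFactor p ℤ_[p] Nw (.good a) 0 ∈ Module.charIdeal (IwasawaAlgebra p) (CharacterModule
          (continuousCohomology 1
            ((AnticyclotomicBigGaloisRep κ ((W.baseChange K).primaryTorsionGaloisRep p)).restrict
              (localMap K (Sum.inl w))).toTopRep)) :=
  sigmaLocal_good_totallySplit' (W.baseChange K) p κ w hw Nw a hdata

end Literature.NumberTheory.EllipticCurves.JetchevSkinnerWan2017

end
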